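import Summits.QuantumFields.YangMills.Theorems.IR.BlockedActivityKPDecayExt
import Summits.QuantumFields.YangMills.Theorems.IR.BlockedActivityKPDecayClusters
import HarnessLib

/-!
# Crux `IR` (stmt-QuantumFields-19354), lane B: EXPONENTIAL DECAY of the far-cell influence on local perturbed expectations in the
# Kotecký–Preiss regime, part 3∕3 — the theorem (generic over the tree's local-perturbation layer; route-independent, Theses-free)

Helper module for item `stmt-QuantumFields-19354` (`--supports`; it closes nothing), lane `ym-19354-onsetsc-p2` (g2; owner R118 (3) GO).

THE ARGUMENT.  By part 1, `⟨F⟩_C = c⁻¹ (e^{W(C)} − 1)` with `c = ε ∕ B` and `W(C)` the cluster sum of the extended system pinned at the new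
cell `∗`; hence `⟨F⟩_C − ⟨F⟩_{C ∖ D} = c⁻¹ e^{W(C∖D)} (e^{W(C) − W(C∖D)} − 1)`, and `W(C) − W(C ∖ D)` runs over the families through `∗` that
contain a polymer MEETING `D`.  A family with non-zero truncated weight is a cluster (tree `truncatedWeight_eq_zero_of_kp`), its union is
`extAdj`-connected from `∗` to `D` (part 2, `isRConnected_biUnion_of_isPolymerCluster`), hence has total size `≥ m + 1` under the distance
hypothesis (`succ_le_card_of_connected_ext`, this file, from part 2's path lemma); the `τ`-weighted pinned bound of part 2 turns this into the
tail `e^{−τ(m+1)}`, and the `1∕ε` of `c⁻¹` cancels against the `ε` of the pinned bound: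

* `norm_pinnedSum_sub_le`: `‖W(C) − W(C ∖ D)‖ ≤ (Δ'+1) 2e^{1+τ} ε · e^{−τ(m+1)}` and `‖W(C ∖ D)‖ ≤ (Δ'+1) 2e^{1+τ} ε ≤ 1`;
* **`norm_pertExpect_sub_pertExpect_sdiff_le`**: for a local perturbation with `≤ Δ` neighbours per cell, an `S`-local `F` with `‖F‖ ≤ B`,
  `0 < B`, `Δ' ≥ Δ + 1, (Δ+1)·#S`, `τ ≥ 0` with `e^{1+τ} ε (Δ'+1)² ≤ 1∕2`, and cells `D` such that every `R`-connected `A ⊆ C` containing a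
  cell touched by `S` and a cell of `D` has `≥ m` cells:  `‖⟨F⟩_C − ⟨F⟩_{C ∖ D}‖ ≤ 4 (Δ'+1) e^{2+τ} · B · e^{−τ(m+1)}`;
* **`norm_pertExpect_sub_pertExpect_le_of_eqOn`**: two local perturbations `g₁, g₂` (same reference and radius) agreeing on `C ∖ D`:
  `‖⟨F⟩_{g₁,C} − ⟨F⟩_{g₂,C}‖ ≤ 8 (Δ'+1) e^{2+τ} · B · e^{−τ(m+1)}` — uniformly in the volume, complex factors allowed.

This is the convergent-expansion form of «exponential decay of boundary influence ∕ of correlations at high temperature» (Friedli–Velenik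
§5.7; Seiler LNP 159 Ch. 2; Kotecký–Preiss (5)).  Its lane-B specialisation (`Theorems/IR/BlockedActivityWDecay`) turns the hand-over radius
of the activity axis into the plain KP radius with a logarithmic window law (owner R118 (3) ask: `r_C`, `w(ε)`).

HONEST FRAMING: an abstract expansion estimate; nothing about Yang–Mills; not a gap, not Clay.  No `sorry`; axioms ⊆ {propext,
Classical.choice, Quot.sound}; no global instances (local `haveI` only), no notation.
Refs: KoteckyPreiss1986 (1), (2), (5); FriedliVelenik2017 §5.7; SeilerLNP1982 Ch. 2; OsterwalderSeilerAnnPhys1978 §3.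
-/

set_option autoImplicit false

noncomputable section

open MeasureTheory ProbabilityTheory Finset
open Literature.Probability.LatticeModels

namespace Summit.QuantumFields.YangMills.Cruxes.IR.BlockedActivity.KP

/-! ## §6a Clusters from the new cell to `D` are long (transport of the distance hypothesis) -/

section Transport

variable {V : Type*} [DecidableEq V] {R : V → V → Prop} {S C D : Finset V} {m : ℕ}

/-- **Clusters from the new cell to `D` are long.**  If every `R`-connected `A ⊆ C` containing a cell touched by `S` and a cell of `D` has
`≥ m` cells, then every `extAdj R S`-connected `U ⊆ C.map some ∪ {∗}` containing `∗` and a cell of `D` has `≥ m + 1` cells (follow an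
`extAdj`-path from the `D`-cell to `∗` inside `U` up to its first visit of `∗`: the cells before it form such an `A`). -/
theorem succ_le_card_of_connected_ext (hR : ∀ x y, R x y → R y x)
    (hfar : ∀ A : Finset V, A ⊆ C → IsRConnected R A → (∃ q ∈ A, q ∈ S ∨ ∃ w ∈ S, R w q) → (∃ d ∈ A, d ∈ D) → m ≤ A.card)
    {U : Finset (Option V)} (hU : U ⊆ insert none (C.map Function.Embedding.some)) (hconn : IsRConnected (extAdj R S) U)
    (h0 : (none : Option V) ∈ U) {d : V} (hd : d ∈ D) (hdU : some d ∈ U) : m + 1 ≤ U.card := by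
  classical
  -- members of `U` other than `∗` are cells of `C`
  have memC : ∀ {a : V}, some a ∈ U → a ∈ C := fun {a} ha => by
    rcases mem_insert.1 (hU ha) with h | h
    · exact absurd h (Option.some_ne_none a)
    · simpa using h
  -- the invariant along an `extAdj`-path from `some d` inside `U`
  let Q : Prop := ∃ A : Finset V, A ⊆ C ∧ IsRConnected R A ∧ (∀ a ∈ A, some a ∈ U) ∧ d ∈ A ∧ ∃ q ∈ A, q ∈ S ∨ ∃ w ∈ S, R w q
  let P : Option V → Prop := fun x =>
    Q ∨ ∃ (A : Finset V) (a : V), x = some a ∧ a ∈ A ∧ A ⊆ C ∧ IsRConnected R A ∧ (∀ a' ∈ A, some a' ∈ U) ∧ d ∈ A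
  have hpath := hconn.2 (some d) hdU none h0
  have key : ∀ x, Relation.ReflTransGen (fun x y => extAdj R S x y ∧ x ∈ U ∧ y ∈ U) (some d) x → P x := by
    intro x hx
    induction hx with
    | refl =>
      exact Or.inr ⟨{d}, d, rfl, mem_singleton_self d, singleton_subset_iff.2 (memC hdU), isRConnected_singleton d,
        fun a ha => by rw [mem_singleton] at ha; subst ha; exact hdU, mem_singleton_self d⟩
    | @tail b y _ hby ih =>
      obtain ⟨hxy, -, hyU⟩ := hby
      rcases ih with hQ | ⟨A, a, hba, haA, hAC, hAconn, hAU, hdA⟩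
      · exact Or.inl hQ
      · subst hba
        cases y with
        | none =>
          exact Or.inl ⟨A, hAC, hAconn, hAU, hdA, a, haA, (extAdj_some_none a).1 hxy⟩
        | some b' =>
          refine Or.inr ⟨insert b' A, b', rfl, mem_insert_self _ _, ?_, ?_, ?_, mem_insert_of_mem hdA⟩
          · exact insert_subset (memC hyU) hAC
          · exact IsRConnected.insert_of_adj hR hAconn haA ((extAdj_some_some a b').1 hxy)
          · intro a' ha'
            rcases mem_insert.1 ha' with rfl | ha'
            · exact hyU
            · exact hAU a' ha'
  have hP : P none := key none hpath
  have hQ : Q := by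
    rcases hP with hQ | ⟨A, a, hnone, -⟩
    · exact hQ
    · exact absurd hnone.symm (Option.some_ne_none a)
  obtain ⟨A, hAC, hAconn, hAU, hdA, hq⟩ := hQ
  have hmA : m ≤ A.card := hfar A hAC hAconn hq ⟨d, hdA, hd⟩
  have hsub : (A.map Function.Embedding.some) ⊆ U.erase none := fun x hx => by
    obtain ⟨a, ha, rfl⟩ := mem_map.1 hx
    exact mem_erase.2 ⟨Option.some_ne_none a, hAU a ha⟩
  have hcard := card_le_card hsub
  rw [card_map, card_erase_of_mem h0] at hcard
  have hUpos : 0 < U.card := card_pos.2 ⟨none, h0⟩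
  omega

end Transport

/-! ## §6 The decay theorem -/

section Decay

variable {V : Type*} [DecidableEq V] {Ω : Type*} {mΩ : MeasurableSpace Ω} {μ : Measure Ω}
  {R : V → V → Prop} {𝓕 : V → MeasurableSpace Ω} {g : V → Ω → ℂ} {ε B τ : ℝ} {F : Ω → ℂ} {S : Finset V}
  {nbr : V → Finset V} {Δ Δ' : ℕ} {m : ℕ}

/-- **The difference of the pinned sums is an exponentially small tail.**  Under `τ ≥ 0`, `e^{1+τ} ε (Δ'+1)² ≤ 1∕2` and the distance
hypothesis `hfar`, `‖W(C) − W(C ∖ D)‖ ≤ (Δ'+1) · 2 e^{1+τ} ε · e^{−τ (m+1)}`; and `‖W(C ∖ D)‖ ≤ (Δ'+1) · 2 e^{1+τ} ε`. -/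
theorem norm_pinnedSum_sub_le [IsProbabilityMeasure μ] (hR : ∀ x y, R x y → R y x)
    (hΔ : ∀ x, (nbr x).card ≤ Δ) (hnbr : ∀ x y, R x y → y ∈ nbr x) (h1 : Δ + 1 ≤ Δ') (h2 : (Δ + 1) * S.card ≤ Δ')
    (h : IsLocalPerturbation μ R 𝓕 g ε) (hF : IsLocalObservable 𝓕 F S B) {c : ℂ} (hc : ‖c‖ * B ≤ ε) (hτ : 0 ≤ τ)
    (hsmall : Real.exp (1 + τ) * ε * ((Δ' : ℝ) + 1) ^ 2 ≤ 1 / 2) {C D : Finset V}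
    (hfar : ∀ A : Finset V, A ⊆ C → IsRConnected R A → (∃ q ∈ A, q ∈ S ∨ ∃ w ∈ S, R w q) → (∃ d ∈ A, d ∈ D) → m ≤ A.card) :
    ‖pinnedSum R S μ (extFactor g F c) (insert none (C.map Function.Embedding.some)) -
        pinnedSum R S μ (extFactor g F c) (insert none ((C \ D).map Function.Embedding.some))‖ ≤
      ((Δ' : ℝ) + 1) * (2 * (Real.exp (1 + τ) * ε)) * Real.exp (-(τ * ((m : ℝ) + 1))) ∧
    ‖pinnedSum R S μ (extFactor g F c) (insert none ((C \ D).map Function.Embedding.some))‖ ≤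
      ((Δ' : ℝ) + 1) * (2 * (Real.exp (1 + τ) * ε)) := by
  classical
  haveI : Std.Symm (extAdj R S) := ⟨extAdj_symm hR⟩
  have h' := isLocalPerturbation_ext hR h hF hc
  have hΔ' := card_extNbr_le (S := S) hΔ h1 h2
  have hnbr' := mem_extNbr (S := S) hnbr
  set R' := extAdj R S with hR'def
  set g' := extFactor g F c with hg'def
  set L := insert none (C.map Function.Embedding.some) with hL
  set L₁ := insert none ((C \ D).map Function.Embedding.some) with hL₁
  set Λ := rconnSubsets R' L with hΛ
  set Λ₁ := rconnSubsets R' L₁ with hΛ₁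
  set Φ := truncatedWeight (GeomInc R') (connActivity R' μ g') with hΦ
  have hL₁L : L₁ ⊆ L := insert_subset_insert _ (map_subset_map.2 sdiff_subset)
  have hΛ₁Λ : Λ₁ ⊆ Λ := rconnSubsets_mono hL₁L
  set P : Finset (Finset (Option V)) → Prop := fun 𝒞 => ∃ X ∈ 𝒞, (none : Option V) ∈ X with hP
  set 𝒜 := Λ.powerset.filter P with h𝒜
  set 𝒜₁ := Λ₁.powerset.filter P with h𝒜₁
  have h𝒜₁𝒜 : 𝒜₁ ⊆ 𝒜 := filter_subset_filter _ (powerset_mono.2 hΛ₁Λ)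
  have hW : pinnedSum R S μ g' L = ∑ 𝒞 ∈ 𝒜, Φ 𝒞 := rfl
  have hW₁ : pinnedSum R S μ g' L₁ = ∑ 𝒞 ∈ 𝒜₁, Φ 𝒞 := rfl
  -- the weighted pinned bound at `{none}` in the volume `L`
  have hnoneΛ : ({none} : Finset (Option V)) ∈ Λ :=
    mem_rconnSubsets.2 ⟨singleton_subset_iff.2 (mem_insert_self _ _), isRConnected_singleton none⟩
  have hpin := sum_norm_truncatedWeight_touching_le_weighted (R := R') hΔ' hnbr' h' hτ hsmall L {none}
  rw [card_singleton, Nat.cast_one, one_mul] at hpin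
  -- every family in `𝒜` touches `{none}`
  have htouch : ∀ 𝒞 ∈ 𝒜, KPTouches (GeomInc R') 𝒞 {none} := fun 𝒞 h𝒞 => by
    obtain ⟨X, hX, hnX⟩ := (mem_filter.1 h𝒞).2
    exact ⟨X, hX, Or.inr ⟨none, hnX, none, mem_singleton_self _, Or.inl rfl⟩⟩
  have h𝒜sub : 𝒜 ⊆ Λ.powerset.filter fun 𝒞 => KPTouches (GeomInc R') 𝒞 {none} := fun 𝒞 h𝒞 =>
    mem_filter.2 ⟨(mem_filter.1 h𝒞).1, htouch 𝒞 h𝒞⟩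
  have hexp_ge_one : ∀ 𝒞 : Finset (Finset (Option V)), 1 ≤ Real.exp (∑ Y ∈ 𝒞, τ * (Y.card : ℝ)) := fun 𝒞 =>
    Real.one_le_exp (sum_nonneg fun Y _ => by positivity)
  constructor
  · -- the difference: families of `𝒜 \ 𝒜₁`
    have hdiff : pinnedSum R S μ g' L - pinnedSum R S μ g' L₁ = ∑ 𝒞 ∈ 𝒜 \ 𝒜₁, Φ 𝒞 := by
      rw [hW, hW₁, ← sum_sdiff h𝒜₁𝒜, add_sub_cancel_right]
    rw [hdiff]
    -- each such family with non-zero weight has size `≥ m + 1`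
    have hKP : IsKPVolume (GeomInc R') (connActivity R' μ g') (fun X => (X.card : ℝ)) Λ :=
      isKPVolume_connActivity hΔ' hnbr' h' (smallness_of_weighted h.nonneg hτ hsmall) Λ
    have hsize : ∀ 𝒞 ∈ 𝒜 \ 𝒜₁, Φ 𝒞 ≠ 0 → m + 1 ≤ ∑ Y ∈ 𝒞, Y.card := by
      intro 𝒞 h𝒞 hΦ
      obtain ⟨h𝒞𝒜, h𝒞𝒜₁⟩ := mem_sdiff.1 h𝒞
      obtain ⟨h𝒞Λ, hP𝒞⟩ := mem_filter.1 h𝒞𝒜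
      have h𝒞Λ' : 𝒞 ⊆ Λ := mem_powerset.1 h𝒞Λ
      -- a polymer of `𝒞` outside `Λ₁`, i.e. meeting `D`
      have hnot : ¬ 𝒞 ⊆ Λ₁ := fun hsub => h𝒞𝒜₁ (mem_filter.2 ⟨mem_powerset.2 hsub, hP𝒞⟩)
      obtain ⟨Y, hY𝒞, hYΛ₁⟩ := not_subset.1 hnot
      obtain ⟨hYL, hYconn⟩ := mem_rconnSubsets.1 (h𝒞Λ' hY𝒞)
      have hYL₁ : ¬ Y ⊆ L₁ := fun hsub => hYΛ₁ (mem_rconnSubsets.2 ⟨hsub, hYconn⟩)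
      obtain ⟨y, hyY, hyL₁⟩ := not_subset.1 hYL₁
      obtain ⟨d, hdD, rfl⟩ : ∃ d ∈ D, y = some d := by
        rcases mem_insert.1 (hYL hyY) with rfl | hy
        · exact absurd (mem_insert_self _ _) hyL₁
        · obtain ⟨d, hdC, rfl⟩ := mem_map.1 hy
          refine ⟨d, ?_, rfl⟩
          by_contra hdD
          exact hyL₁ (mem_insert_of_mem (mem_map_of_mem _ (mem_sdiff.2 ⟨hdC, hdD⟩)))
      -- the family is a cluster, so its union is connected
      have hcl : IsPolymerCluster (GeomInc R') 𝒞 := by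
        by_contra hcl
        exact hΦ (truncatedWeight_eq_zero_of_kp hKP h𝒞Λ' hcl)
      obtain ⟨X, hX𝒞, hnX⟩ := hP𝒞
      have hUconn := isRConnected_biUnion_of_isPolymerCluster ⟨X, hX𝒞⟩ (fun Z hZ => (mem_rconnSubsets.1 (h𝒞Λ' hZ)).2) hcl
      have hUsub : 𝒞.biUnion id ⊆ L := biUnion_subset.2 fun Z hZ => (mem_rconnSubsets.1 (h𝒞Λ' hZ)).1
      have hcard := succ_le_card_of_connected_ext hR hfar hUsub hUconn (mem_biUnion.2 ⟨X, hX𝒞, hnX⟩) hdD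
        (mem_biUnion.2 ⟨Y, hY𝒞, hyY⟩)
      exact hcard.trans card_biUnion_le
    -- termwise: `‖Φ 𝒞‖ ≤ e^{-τ(m+1)} ‖Φ 𝒞‖ e^{τ Σ #Y}`
    have hterm : ∀ 𝒞 ∈ 𝒜 \ 𝒜₁, ‖Φ 𝒞‖ ≤
        Real.exp (-(τ * ((m : ℝ) + 1))) * (‖Φ 𝒞‖ * Real.exp (∑ Y ∈ 𝒞, τ * (Y.card : ℝ))) := by
      intro 𝒞 h𝒞
      by_cases hΦ : Φ 𝒞 = 0
      · rw [hΦ, norm_zero, zero_mul, mul_zero]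
      · have hsz : (m : ℝ) + 1 ≤ ∑ Y ∈ 𝒞, (Y.card : ℝ) := by
          have := hsize 𝒞 h𝒞 hΦ
          exact_mod_cast this
        have hτsum : ∑ Y ∈ 𝒞, τ * (Y.card : ℝ) = τ * ∑ Y ∈ 𝒞, (Y.card : ℝ) := by rw [mul_sum]
        rw [hτsum, ← mul_assoc, mul_comm (Real.exp _) ‖Φ 𝒞‖, mul_assoc, ← Real.exp_add]
        refine le_mul_of_one_le_right (norm_nonneg _) (Real.one_le_exp ?_)
        nlinarith
    calc ‖∑ 𝒞 ∈ 𝒜 \ 𝒜₁, Φ 𝒞‖ ≤ ∑ 𝒞 ∈ 𝒜 \ 𝒜₁, ‖Φ 𝒞‖ := norm_sum_le _ _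
      _ ≤ ∑ 𝒞 ∈ 𝒜 \ 𝒜₁, Real.exp (-(τ * ((m : ℝ) + 1))) * (‖Φ 𝒞‖ * Real.exp (∑ Y ∈ 𝒞, τ * (Y.card : ℝ))) :=
          sum_le_sum hterm
      _ = Real.exp (-(τ * ((m : ℝ) + 1))) * ∑ 𝒞 ∈ 𝒜 \ 𝒜₁, ‖Φ 𝒞‖ * Real.exp (∑ Y ∈ 𝒞, τ * (Y.card : ℝ)) := by
          rw [mul_sum]
      _ ≤ Real.exp (-(τ * ((m : ℝ) + 1))) * ∑ 𝒞 ∈ Λ.powerset with KPTouches (GeomInc R') 𝒞 {none},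
            ‖Φ 𝒞‖ * Real.exp (∑ Y ∈ 𝒞, τ * (Y.card : ℝ)) := by
          refine mul_le_mul_of_nonneg_left ?_ (Real.exp_nonneg _)
          exact sum_le_sum_of_subset_of_nonneg (sdiff_subset.trans h𝒜sub) fun _ _ _ => by positivity
      _ ≤ Real.exp (-(τ * ((m : ℝ) + 1))) * (((Δ' : ℝ) + 1) * (2 * (Real.exp (1 + τ) * ε))) :=
          mul_le_mul_of_nonneg_left hpin (Real.exp_nonneg _)
      _ = ((Δ' : ℝ) + 1) * (2 * (Real.exp (1 + τ) * ε)) * Real.exp (-(τ * ((m : ℝ) + 1))) := by ring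
  · -- the pinned sum itself
    have hpin₁ := sum_norm_truncatedWeight_touching_le_weighted (R := R') hΔ' hnbr' h' hτ hsmall L₁ {none}
    rw [card_singleton, Nat.cast_one, one_mul] at hpin₁
    have h𝒜₁sub : 𝒜₁ ⊆ Λ₁.powerset.filter fun 𝒞 => KPTouches (GeomInc R') 𝒞 {none} := fun 𝒞 h𝒞 =>
      mem_filter.2 ⟨(mem_filter.1 h𝒞).1, htouch 𝒞 (h𝒜₁𝒜 h𝒞)⟩
    rw [hW₁]
    calc ‖∑ 𝒞 ∈ 𝒜₁, Φ 𝒞‖ ≤ ∑ 𝒞 ∈ 𝒜₁, ‖Φ 𝒞‖ := norm_sum_le _ _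
      _ ≤ ∑ 𝒞 ∈ 𝒜₁, ‖Φ 𝒞‖ * Real.exp (∑ Y ∈ 𝒞, τ * (Y.card : ℝ)) :=
          sum_le_sum fun 𝒞 _ => le_mul_of_one_le_right (norm_nonneg _) (hexp_ge_one 𝒞)
      _ ≤ ∑ 𝒞 ∈ Λ₁.powerset with KPTouches (GeomInc R') 𝒞 {none}, ‖Φ 𝒞‖ * Real.exp (∑ Y ∈ 𝒞, τ * (Y.card : ℝ)) :=
          sum_le_sum_of_subset_of_nonneg h𝒜₁sub fun _ _ _ => by positivity
      _ ≤ ((Δ' : ℝ) + 1) * (2 * (Real.exp (1 + τ) * ε)) := hpin₁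

omit [DecidableEq V] in
/-- `pertExpect` depends only on the factors of the cells of `C`. -/
theorem pertExpect_congr {g₁ g₂ : V → Ω → ℂ} {C : Finset V} (hg : ∀ p ∈ C, g₁ p = g₂ p) (F : Ω → ℂ) :
    pertExpect μ g₁ F C = pertExpect μ g₂ F C := by
  unfold pertExpect pertNum pertZ
  have : ∀ ω, ∏ p ∈ C, (1 + g₁ p ω) = ∏ p ∈ C, (1 + g₂ p ω) := fun ω => prod_congr rfl fun p hp => by rw [hg p hp]
  simp_rw [this]

omit [DecidableEq V] in
/-- With all factors zero the perturbed expectation is the reference expectation. -/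
theorem pertExpect_eq_integral_of_forall_eq_zero [IsProbabilityMeasure μ] {C : Finset V} (hg : ∀ p ∈ C, g p = 0) (F : Ω → ℂ) :
    pertExpect μ g F C = ∫ ω, F ω ∂μ := by
  unfold pertExpect pertNum pertZ
  have : ∀ ω, ∏ p ∈ C, (1 + g p ω) = 1 := fun ω => prod_eq_one fun p hp => by rw [hg p hp]; simp
  simp_rw [this, mul_one]
  simp

/-- **EXPONENTIAL DECAY OF THE FAR-CELL INFLUENCE** (uniform in the volume, complex factors allowed).  Let `(μ, R, 𝓕, g, ε)` be a local
perturbation with `≤ Δ` neighbours per cell, `F` an `S`-local observable with `‖F‖ ≤ B`, `Δ' ≥ Δ + 1, (Δ+1) #S`, `τ ≥ 0` with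
`e^{1+τ} ε (Δ'+1)² ≤ 1∕2`, and `D ⊆ C` a set of cells such that every `R`-connected `A ⊆ C` containing a cell touched by `S` and a cell
of `D` has at least `m` cells.  Then dropping the factors of `D` moves the perturbed expectation of `F` by at most
`4 (Δ'+1) e^{2+τ} B e^{−τ(m+1)}`: `‖⟨F⟩_C − ⟨F⟩_{C ∖ D}‖ ≤ 4 (Δ'+1) e^{2+τ} · B · exp (−τ (m+1))`. -/
theorem norm_pertExpect_sub_pertExpect_sdiff_le [IsProbabilityMeasure μ] (hR : ∀ x y, R x y → R y x)
    (hΔ : ∀ x, (nbr x).card ≤ Δ) (hnbr : ∀ x y, R x y → y ∈ nbr x) (h1 : Δ + 1 ≤ Δ') (h2 : (Δ + 1) * S.card ≤ Δ')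
    (h : IsLocalPerturbation μ R 𝓕 g ε) (hF : IsLocalObservable 𝓕 F S B) (hB : 0 < B) (hτ : 0 ≤ τ)
    (hsmall : Real.exp (1 + τ) * ε * ((Δ' : ℝ) + 1) ^ 2 ≤ 1 / 2) {C D : Finset V}
    (hfar : ∀ A : Finset V, A ⊆ C → IsRConnected R A → (∃ q ∈ A, q ∈ S ∨ ∃ w ∈ S, R w q) → (∃ d ∈ A, d ∈ D) → m ≤ A.card) :
    ‖pertExpect μ g F C - pertExpect μ g F (C \ D)‖ ≤
      4 * ((Δ' : ℝ) + 1) * Real.exp (2 + τ) * B * Real.exp (-(τ * ((m : ℝ) + 1))) := by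
  classical
  have hε := h.nonneg
  by_cases hε0 : ε = 0
  · -- all factors vanish: both expectations are the reference one
    have hg0 : ∀ p, g p = 0 := fun p => by
      funext ω; have := h.norm_le p ω; rw [hε0] at this; exact norm_le_zero_iff.1 this
    rw [pertExpect_eq_integral_of_forall_eq_zero (fun p _ => hg0 p), pertExpect_eq_integral_of_forall_eq_zero (fun p _ => hg0 p),
      sub_self, norm_zero]
    positivity
  have hεpos : 0 < ε := lt_of_le_of_ne hε (Ne.symm hε0)
  -- the multiplier `c = ε / B`
  set c : ℂ := ((ε / B : ℝ) : ℂ) with hcdef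
  have hcnorm : ‖c‖ = ε / B := by rw [hcdef, Complex.norm_real, Real.norm_eq_abs, abs_of_pos (div_pos hεpos hB)]
  have hc : ‖c‖ * B ≤ ε := by rw [hcnorm, div_mul_cancel₀ _ hB.ne']
  have hc0 : c ≠ 0 := by
    rw [← norm_pos_iff, hcnorm]; exact div_pos hεpos hB
  have hsmall1 := smallness_of_weighted hε hτ hsmall
  -- the two expectations as pinned sums
  rw [pertExpect_eq_pinnedSum hR hΔ hnbr h1 h2 h hF hc0 hc hsmall1 C,
    pertExpect_eq_pinnedSum hR hΔ hnbr h1 h2 h hF hc0 hc hsmall1 (C \ D)]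
  set W := pinnedSum R S μ (extFactor g F c) (insert none (C.map Function.Embedding.some)) with hWdef
  set W₁ := pinnedSum R S μ (extFactor g F c) (insert none ((C \ D).map Function.Embedding.some)) with hW₁def
  obtain ⟨hdW, hW₁⟩ := norm_pinnedSum_sub_le hR hΔ hnbr h1 h2 h hF hc hτ hsmall hfar
  set η : ℝ := ((Δ' : ℝ) + 1) * (2 * (Real.exp (1 + τ) * ε)) with hηdef
  have hη1 : η ≤ 1 := two_mul_exp_mul_le_one hε hsmall
  have hη0 : 0 ≤ η := by positivity
  have hexpτ : Real.exp (-(τ * ((m : ℝ) + 1))) ≤ 1 := by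
    rw [Real.exp_le_one_iff]; nlinarith [Nat.cast_nonneg (α := ℝ) m]
  have hdW1 : ‖W - W₁‖ ≤ 1 := hdW.trans ((mul_le_of_le_one_right hη0 hexpτ).trans hη1)
  -- `c⁻¹ (e^W − 1) − c⁻¹ (e^{W₁} − 1) = c⁻¹ e^{W₁} (e^{W − W₁} − 1)`
  have hkey : c⁻¹ * (Complex.exp W - 1) - c⁻¹ * (Complex.exp W₁ - 1) = c⁻¹ * (Complex.exp W₁ * (Complex.exp (W - W₁) - 1)) := by
    have hne : Complex.exp W₁ ≠ 0 := Complex.exp_ne_zero _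
    rw [Complex.exp_sub, mul_sub (Complex.exp W₁), mul_div_cancel₀ _ hne]
    ring
  rw [hkey, norm_mul, norm_inv, hcnorm, norm_mul, Complex.norm_exp, inv_div]
  -- `‖e^{W − W₁} − 1‖ ≤ 2 ‖W − W₁‖` and `Re W₁ ≤ ‖W₁‖ ≤ 1`
  have hre : W₁.re ≤ 1 := (Complex.re_le_norm W₁).trans (hW₁.trans hη1)
  have hexpW₁ : Real.exp W₁.re ≤ Real.exp 1 := Real.exp_le_exp.2 hre
  have hsub1 : ‖Complex.exp (W - W₁) - 1‖ ≤ 2 * ‖W - W₁‖ := by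
    refine (norm_cexp_sub_one_le_exp_norm_sub_one (W - W₁)).trans ?_
    have := Real.abs_exp_sub_one_le (x := ‖W - W₁‖) (by rw [abs_of_nonneg (norm_nonneg _)]; exact hdW1)
    rw [abs_of_nonneg (norm_nonneg _)] at this
    exact (le_abs_self _).trans this
  calc B / ε * (Real.exp W₁.re * ‖Complex.exp (W - W₁) - 1‖)
      ≤ B / ε * (Real.exp 1 * (2 * (η * Real.exp (-(τ * ((m : ℝ) + 1)))))) := by
        have hBε : 0 ≤ B / ε := by positivity
        refine mul_le_mul_of_nonneg_left ?_ hBε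
        exact mul_le_mul hexpW₁ (hsub1.trans (by linarith [hdW])) (norm_nonneg _) (Real.exp_nonneg _)
    _ = 4 * ((Δ' : ℝ) + 1) * (Real.exp 1 * Real.exp (1 + τ)) * B * Real.exp (-(τ * ((m : ℝ) + 1))) * (ε / ε) := by
        rw [hηdef]; ring
    _ = 4 * ((Δ' : ℝ) + 1) * Real.exp (2 + τ) * B * Real.exp (-(τ * ((m : ℝ) + 1))) := by
        have he : Real.exp 1 * Real.exp (1 + τ) = Real.exp (2 + τ) := by rw [← Real.exp_add]; ring_nf
        rw [div_self hε0, mul_one, he]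

/-- **Two local perturbations agreeing off `D`** (same reference, same radius): under the hypotheses of
`norm_pertExpect_sub_pertExpect_sdiff_le`, if `g₁ p = g₂ p` for `p ∈ C ∖ D` then
`‖⟨F⟩_{g₁,C} − ⟨F⟩_{g₂,C}‖ ≤ 8 (Δ'+1) e^{2+τ} · B · exp (−τ (m+1))`. -/
theorem norm_pertExpect_sub_pertExpect_le_of_eqOn [IsProbabilityMeasure μ] (hR : ∀ x y, R x y → R y x)
    (hΔ : ∀ x, (nbr x).card ≤ Δ) (hnbr : ∀ x y, R x y → y ∈ nbr x) (h1 : Δ + 1 ≤ Δ') (h2 : (Δ + 1) * S.card ≤ Δ')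
    {g₁ g₂ : V → Ω → ℂ} (hg₁ : IsLocalPerturbation μ R 𝓕 g₁ ε) (hg₂ : IsLocalPerturbation μ R 𝓕 g₂ ε)
    (hF : IsLocalObservable 𝓕 F S B) (hB : 0 < B) (hτ : 0 ≤ τ)
    (hsmall : Real.exp (1 + τ) * ε * ((Δ' : ℝ) + 1) ^ 2 ≤ 1 / 2) {C D : Finset V}
    (hfar : ∀ A : Finset V, A ⊆ C → IsRConnected R A → (∃ q ∈ A, q ∈ S ∨ ∃ w ∈ S, R w q) → (∃ d ∈ A, d ∈ D) → m ≤ A.card)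
    (heq : ∀ p ∈ C, p ∉ D → g₁ p = g₂ p) :
    ‖pertExpect μ g₁ F C - pertExpect μ g₂ F C‖ ≤
      8 * ((Δ' : ℝ) + 1) * Real.exp (2 + τ) * B * Real.exp (-(τ * ((m : ℝ) + 1))) := by
  have hmid : pertExpect μ g₁ F (C \ D) = pertExpect μ g₂ F (C \ D) :=
    pertExpect_congr (fun p hp => heq p (mem_sdiff.1 hp).1 (mem_sdiff.1 hp).2) F
  have e1 := norm_pertExpect_sub_pertExpect_sdiff_le hR hΔ hnbr h1 h2 hg₁ hF hB hτ hsmall hfar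
  have e2 := norm_pertExpect_sub_pertExpect_sdiff_le hR hΔ hnbr h1 h2 hg₂ hF hB hτ hsmall hfar
  calc ‖pertExpect μ g₁ F C - pertExpect μ g₂ F C‖
      = ‖(pertExpect μ g₁ F C - pertExpect μ g₁ F (C \ D)) - (pertExpect μ g₂ F C - pertExpect μ g₂ F (C \ D))‖ := by
        rw [hmid]; congr 1; ring
    _ ≤ ‖pertExpect μ g₁ F C - pertExpect μ g₁ F (C \ D)‖ + ‖pertExpect μ g₂ F C - pertExpect μ g₂ F (C \ D)‖ :=
        norm_sub_le _ _
    _ ≤ _ := by linarith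

end Decay

end Summit.QuantumFields.YangMills.Cruxes.IR.BlockedActivity.KP

end
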